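import Literature.NumberTheory.Automorphic.HarishChandraStep2GL
import Literature.NumberTheory.Automorphic.AutomorphicRepsGLCuspidalL2Step1Bump
import HarnessLib

/-!
# Harish-Chandra's convolution identity for `GL_n` from his admissibility theorem (Borel 1972,
Thm. 3.17 and the proof of Thm. 3.18): the trust base of Step 2 of Borel–Jacquet 4.6 moved one
step up

Topic `NumberTheory/Automorphic`; sibling of `HarishChandraConvolutionGL` (the named fact
`AutomorphicRepsGL.exists_convolution_eq_self hcpt`: for an automorphic form `φ` on `GL_n(𝔸_K)`
there is `α ∈ C_c^∞(GL_n(K_∞))` with `φ(g) = ∫ φ(g x) α(x) dx`) and of `HarishChandraStep2GL`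
(Step 2 of Borel–Jacquet 1979, 4.6 for `GL_n`, in particular the `L²` side
`AutomorphicRepsGL.exists_toLp_mem_invQuot_eq_lieDeriv hcpt μ` of `AutomorphicRepsGLCuspidalL2Step2`,
from that fact alone). The convolution identity is Borel 1972, Thm. 3.18 / Cor. 3.19
(Harish-Chandra 1966, Thm. 1). Its printed proof (LNM 276, p. 26) has two layers:

* the **deep layer**, Harish-Chandra's admissibility theorem 3.17: for a `K`-finite `Z(𝔤)`-finite
  differentiable vector `v` of a permissible continuous representation `π` of a connected
  reductive Lie group `G`, the closure `W` of `π(U(𝔤)) v` is `G`-stable and its `K`-isotypic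
  components `W_λ` are finite-dimensional; whence, for `J` the `Int K`-invariant test functions,
  `P = {π(f) v | f ∈ J}` is a linear subspace of the finite-dimensional space `W_F = Σ_{λ ∈ F} W_λ`
  (`F` the finite set of `K`-types of `v`; `π(f) W_λ ⊆ W_λ` by 3.5);
* the **soft layer**: `J` contains Dirac sequences (3.4), so `v` lies in the closure of `P`, and a
  finite-dimensional subspace is closed, so `v ∈ P`, i.e. `v = π(f) v` for some `f ∈ J`.

This file records the deep layer, specialised to automorphic forms on `GL_n(𝔸_K)`, as ONE named
fact and PROVES the soft layer, so that `exists_convolution_eq_self hcpt` — and with it both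
refined inputs of Step 2 (`hasModerateGrowth_lieDeriv`, `exists_toLp_mem_invQuot_eq_lieDeriv`) —
rest on Harish-Chandra's admissibility theorem (3.17) alone:

* `norm_integral_mul_sub_le`, `tendsto_integral_mul_of_support_subset` — the Dirac estimate
  `‖∫ ψ β dν - a‖ ≤ δ` for a probability weight `β ≥ 0` with `‖ψ - a‖ ≤ δ` on its support, and
  `∫ ψ β_m dν → ψ(x₀)` when the supports shrink to `x₀` (Borel 1972, 3.4 (1));
* `exists_closedBall_subset_range_val`, `isCompact_val_preimage_closedBall`,
  `val_preimage_closedBall_subset_connectedComponent`, `exists_norm_lt_imp_mem_of_mem_nhds` —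
  small closed balls around `1` in `M_n(K ⊗ ℝ)` pull back to compact connected neighbourhoods of
  `1` in `GL_n(K ⊗ ℝ)` forming a neighbourhood basis (`Units.val` is an open embedding);
* `admissibleWeightsGL n K` — the space `J` of Borel's proof for `G = GL_n(K ⊗ ℝ)°`: continuous,
  compactly supported, archimedean-smooth complex functions on `GL_n(K ⊗ ℝ)` supported in the
  identity component and invariant under conjugation by `K_∞ = U(n, K ⊗ ℝ)` (a complex subspace);
  the `Ad K_∞`-invariant bumps `archBump` of `AutomorphicRepsGLCuspidalL2Step1Bump` with small
  radius belong to it (`archBump_mem_admissibleWeightsGL`), and normalised they form a Dirac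
  sequence (`exists_dirac_admissibleWeightsGL`; Borel 1972, 3.4: "on peut toujours trouver une suite
  de Dirac formée d'éléments invariants par `Int_G K`");
* `AutomorphicRepsGL.exists_finiteDimensional_convolution_mem hcpt` (**named fact**, Borel 1972,
  Thm. 3.17 with the first half of the proof of Thm. 3.18): for an automorphic form `φ` on
  `GL_n(𝔸_K)` there is a finite-dimensional space of functions containing `φ ∗ α̌ =
  (g ↦ ∫ φ(g x) α(x) dν)` for every admissible `α` — Harish-Chandra's ADMISSIBILITY theorem for
  the closed module generated by one form over the archimedean group, not to be confused with the
  tree's `harishChandra_finiteness_gl` (`AutomorphicRepsGL`; Borel–Jacquet 1979, 4.3 (i): the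
  forms of fixed level, `Z(𝔤)`-character and `K_∞`-types span a finite-dimensional space, a
  global statement resting on reduction theory);
* `AutomorphicRepsGL.exists_convolution_eq_self_of_finiteDimensional` (**proved**, the second
  half of the proof of Thm. 3.18): the named fact implies `exists_convolution_eq_self hcpt`;
* `AutomorphicRepsGL.hasModerateGrowth_lieDeriv_of_finiteDimensional`,
  `AutomorphicRepsGL.exists_toLp_mem_invQuot_eq_lieDeriv_of_finiteDimensional`,
  `AutomorphicRepsGL.formsOfL2_isStableSubmodule_of_finiteDimensional` — Step 2 of Borel–Jacquet
  4.6 for `GL_n` on the trust base `{exists_finiteDimensional_convolution_mem}`.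

## Why the specialisation follows from the printed theorem

Borel's standing hypotheses (§3, p. 14): `V` a quasi-complete Hausdorff locally convex space, `G`
locally compact unimodular, `π` continuous (`G × V → V` continuous); in 3.14–3.18 `G` is moreover
a connected reductive Lie group, `K` the analytic subgroup of a maximal compact subalgebra of the
derived algebra `D𝔤`, and `π` is *permissible* (3.16). As recorded in the docstring of the sibling
fact `exists_convolution_eq_self` (`HarishChandraConvolutionGL`), Thm. 3.17 is not applied to the
identity component `G° = GL_n(K ⊗ ℝ)°` itself — its centre `C ≅ ∏ ℝ_{>0} × ∏ ℂ^×` is not compact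
and central translations of functions are not homotheties (cf. the remark of 3.16 "permise si `K`
est compact, ce qui équivaut à dire que le centre de `G` est compact") — but to its semisimple
part. Write `G° = C · G₁` with `C` the connected centre and `G₁ = ∏_w SL_n(K_w)`, a connected
semisimple Lie group with FINITE centre, so that `K₁ = ∏_{w real} SO(n) × ∏_{w complex} SU(n)` is
compact and every continuous representation of `G₁` is permissible (3.16), in particular the
right regular representation `π₁` of `G₁` on `V = C(GL_n(𝔸_K))` (compact-open topology;
continuous by 3.2, Remarks (3)–(4)). An automorphic form `φ` is a differentiable vector of `V`
(all `U(𝔤)`-derivatives are archimedean-smooth and level-invariant, hence continuous,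
`continuous_of_isArchSmooth_of_isRightInvariantUnder`), `K_∞`-finite and `Z(𝔤)`-finite, where
`𝔤 = 𝔤₁ ⊕ 𝔷` (`𝔷 = Lie C`) and `Z(𝔤) = Z(𝔤₁) ⊗ U(𝔷)`. Hence (i) `φ` is `K₁`-finite (`K₁ ≤ K_∞`) and
`Z(𝔤₁)`-finite; (ii) `E = U(𝔷) φ` is a finite-dimensional space of `K_∞`-finite, `Z(𝔤)`-finite
differentiable vectors (`𝔷` commutes with `K_∞` and with `U(𝔤)`), stable under the central
translations `r(c)`, `c ∈ C = exp 𝔷` (on `E`, `t ↦ r(exp tY)`, `Y ∈ 𝔷`, solves the linear ODE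
with the constant matrix `Y|_E`); write `r(c) φ = Σ_i c_i(c) φ_i` in a basis `φ_1, …, φ_r` of `E`,
with smooth `c_i : C → ℂ`. For an admissible `α` (smooth, compactly supported in `G°`,
`Ad K_∞`-invariant), integrating over `C × G₁ → G°` (a surjective homomorphism with finite kernel)
gives `π(α) φ = ∫_{G°} α(x) r(x) φ dx = Σ_i π₁(α_i) φ_i` with
`α_i(g₁) = κ ∫_C α(c g₁) c_i(c) dc ∈ D(G₁)`, which is `Int K₁`-invariant because `C` is central
and `K₁ ≤ K_∞`. By Thm. 3.17 applied to `π₁` and each `φ_i`, the closure `W(φ_i)` of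
`π₁(U(𝔤₁)) φ_i` is `G₁`-stable with finite-dimensional `K₁`-isotypic components, and — the first
half of the proof of Thm. 3.18 (p. 26) — `π₁(α_i) φ_i ∈ W(φ_i)_{F_i}` for the finite set `F_i` of
`K₁`-types of `φ_i` (`π₁(f) W_λ ⊆ W_λ` for `Int K₁`-invariant `f`, 3.5). So
`V₀ := Σ_i W(φ_i)_{F_i}` is finite-dimensional, contains `π(α) φ = (g ↦ ∫ φ(g x) α(x) dν(x))` for
every admissible `α`, and depends neither on `α` nor on the normalisation of the Haar measure.
What is NOT here: Thm. 3.17 itself (whose proof rests on the analyticity of `K`-finite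
`Z(𝔤)`-finite vectors, 3.14–3.15, elliptic regularity, and on Harish-Chandra's algebraic
finiteness theorem for `U(𝔤)`-modules, 1.4–1.5) — it is the named fact below.

## References

* A. Borel, *Représentations de groupes localement compacts*, LNM 276 (1972), §3.2, 3.4, 3.5,
  3.16, Thm. 3.17, Thm. 3.18 and its proof (p. 26), Cor. 3.19 [Borel1972].
* Harish-Chandra, *Discrete series for semisimple Lie groups. II*, Acta Math. 116 (1966), Thm. 1
  [HarishChandra1966].
* A. Borel, H. Jacquet, *Automorphic forms and automorphic representations*, Proc. Sympos. Pure
  Math. 33 (1979), part 1, 4.3 (ii) and 4.6 [BorelJacquet1979].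
-/

-- Mathlib idiom (Mathlib/Algebra/Lie/OfAssociative.lean); needed to mention Lie subalgebras of matrix algebras
attribute [local instance 100] LieRing.ofAssociativeRing

open scoped MatrixGroups Matrix ContDiff Classical Topology
open NumberField NumberField.mixedEmbedding IsDedekindDomain Filter Set
open _root_.MeasureTheory _root_.MeasureTheory.Measure

noncomputable section

namespace Literature.NumberTheory.Automorphic

-- `M_n(K ⊗ ℝ)` is finite-dimensional over `ℝ` (the tree's instance, as in
-- `AutomorphicRepsGLCuspidalL2Step1Bump`)
attribute [local instance] finiteDimensional_matrix_mixedSpace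

/-! ### 1. The Dirac estimate -/

section Dirac

variable {X : Type*} [MeasurableSpace X] {ν : Measure X}

/-- **The Dirac estimate** (Borel 1972, 3.4 (1): `ν(π(f_j) v - v) ≤ ∫ f_j(x) ν(π(x) v - v) dx ≤ ε`):
if `β ≥ 0` has integral `1` and `‖ψ(x) - a‖ ≤ δ` wherever `β(x) ≠ 0`, then
`‖∫ ψ β dν - a‖ ≤ δ`. [cite: Borel1972, 3.4 (1)] -/
theorem norm_integral_mul_sub_le {ψ : X → ℂ} {β : X → ℝ} {a : ℂ} {δ : ℝ}
    (hβ0 : ∀ x, 0 ≤ β x) (hβ1 : ∫ x, β x ∂ν = 1) (hβi : Integrable β ν)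
    (hψβ : Integrable (fun x ↦ ψ x * (β x : ℂ)) ν) (hδ : ∀ x, β x ≠ 0 → ‖ψ x - a‖ ≤ δ) :
    ‖(∫ x, ψ x * (β x : ℂ) ∂ν) - a‖ ≤ δ := by
  have hβC : Integrable (fun x ↦ (β x : ℂ)) ν := hβi.ofReal
  have ha : (∫ x, a * (β x : ℂ) ∂ν) = a := by
    rw [integral_const_mul, integral_complex_ofReal, hβ1, Complex.ofReal_one, mul_one]
  have hsub : (∫ x, ψ x * (β x : ℂ) ∂ν) - a = ∫ x, (ψ x - a) * (β x : ℂ) ∂ν := by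
    conv_lhs => rw [← ha]
    rw [← integral_sub hψβ (hβC.const_mul a)]
    congr 1 with x
    ring
  rw [hsub]
  have hbound : ∀ x, ‖(ψ x - a) * (β x : ℂ)‖ ≤ δ * β x := by
    intro x
    rw [norm_mul, Complex.norm_real, Real.norm_eq_abs, abs_of_nonneg (hβ0 x)]
    by_cases hx : β x = 0
    · rw [hx, mul_zero, mul_zero]
    · exact mul_le_mul_of_nonneg_right (hδ x hx) (hβ0 x)
  calc ‖∫ x, (ψ x - a) * (β x : ℂ) ∂ν‖ ≤ ∫ x, δ * β x ∂ν :=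
        norm_integral_le_of_norm_le (hβi.const_mul δ) (Eventually.of_forall hbound)
    _ = δ := by rw [integral_const_mul, hβ1, mul_one]

/-- **Dirac sequences reproduce continuous functions** (Borel 1972, 3.4 (1):
`lim_j π(f_j) v = v`): if `β_m ≥ 0` are integrable probability weights on a topological space whose
supports shrink into every neighbourhood of `x₀`, and `ψ` is continuous at `x₀` with `ψ β_m`
integrable, then `∫ ψ β_m dν → ψ(x₀)`. [cite: Borel1972, 3.4 (1)] -/
theorem tendsto_integral_mul_of_support_subset [TopologicalSpace X] {x₀ : X} {ψ : X → ℂ}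
    (hψ : ContinuousAt ψ x₀) {β : ℕ → X → ℝ} (hβ0 : ∀ m x, 0 ≤ β m x)
    (hβ1 : ∀ m, ∫ x, β m x ∂ν = 1) (hβi : ∀ m, Integrable (β m) ν)
    (hψβ : ∀ m, Integrable (fun x ↦ ψ x * (β m x : ℂ)) ν)
    (hsupp : ∀ U ∈ 𝓝 x₀, ∀ᶠ m in atTop, Function.support (β m) ⊆ U) :
    Tendsto (fun m ↦ ∫ x, ψ x * (β m x : ℂ) ∂ν) atTop (𝓝 (ψ x₀)) := by
  rw [Metric.tendsto_atTop]
  intro ε hε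
  have hU : {x | dist (ψ x) (ψ x₀) < ε / 2} ∈ 𝓝 x₀ :=
    (Metric.tendsto_nhds.1 hψ) (ε / 2) (half_pos hε)
  obtain ⟨N, hN⟩ := eventually_atTop.1 (hsupp _ hU)
  refine ⟨N, fun m hm ↦ ?_⟩
  have hδ : ∀ x, β m x ≠ 0 → ‖ψ x - ψ x₀‖ ≤ ε / 2 := fun x hx ↦ by
    have h := hN m hm (Function.mem_support.2 hx)
    rw [mem_setOf_eq, dist_eq_norm] at h
    exact h.le
  rw [dist_eq_norm]
  exact (norm_integral_mul_sub_le (hβ0 m) (hβ1 m) (hβi m) (hψβ m) hδ).trans_lt (half_lt_self hε)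

end Dirac

/-! ### 2. Small balls around `1` in `GL_n(K ⊗ ℝ)` -/

section Balls

variable {n : ℕ} {K : Type} [Field K] [NumberField K]

-- the scoped operator norm on `𝔤𝔩_n(K_∞)` (the one through which `IsArchSmooth` is defined); the
-- metric arguments below do not depend on the choice
open scoped Matrix.Norms.Operator

set_option backward.isDefEq.respectTransparency false in
/-- Some closed ball around `1` in `M_n(K ⊗ ℝ)` consists of invertible matrices (the units of a
Banach algebra are open). [folklore] -/
theorem exists_closedBall_subset_range_val :
    ∃ ε > (0 : ℝ), Metric.closedBall (1 : Matrix (Fin n) (Fin n) (mixedSpace K)) ε ⊆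
      range (Units.val : GL (Fin n) (mixedSpace K) → Matrix (Fin n) (Fin n) (mixedSpace K)) := by
  have hopen : IsOpen (range (Units.val :
      GL (Fin n) (mixedSpace K) → Matrix (Fin n) (Fin n) (mixedSpace K))) :=
    (Units.isOpenEmbedding_val (R := Matrix (Fin n) (Fin n) (mixedSpace K))).isOpen_range
  obtain ⟨ε, hε, hball⟩ := Metric.mem_nhds_iff.1 (hopen.mem_nhds ⟨1, Units.val_one⟩)
  exact ⟨ε / 2, half_pos hε, (Metric.closedBall_subset_ball (half_lt_self hε)).trans hball⟩

set_option backward.isDefEq.respectTransparency false in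
/-- The preimage in `GL_n(K ⊗ ℝ)` of a closed ball of invertible matrices around `1` is compact
(`Units.val` is an embedding and the ball is compact, `M_n(K ⊗ ℝ)` being finite-dimensional).
[folklore] -/
theorem isCompact_val_preimage_closedBall {ε : ℝ}
    (hε : Metric.closedBall (1 : Matrix (Fin n) (Fin n) (mixedSpace K)) ε ⊆
      range (Units.val : GL (Fin n) (mixedSpace K) → Matrix (Fin n) (Fin n) (mixedSpace K))) :
    IsCompact ((Units.val : GL (Fin n) (mixedSpace K) → Matrix (Fin n) (Fin n) (mixedSpace K)) ⁻¹'
      Metric.closedBall 1 ε) := by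
  haveI : ProperSpace (Matrix (Fin n) (Fin n) (mixedSpace K)) := FiniteDimensional.proper ℝ _
  exact (Units.isOpenEmbedding_val
    (R := Matrix (Fin n) (Fin n) (mixedSpace K))).isInducing.isCompact_preimage'
      (isCompact_closedBall _ _) hε

set_option backward.isDefEq.respectTransparency false in
/-- The preimage in `GL_n(K ⊗ ℝ)` of a closed ball of invertible matrices around `1` lies in the
identity component of `GL_n(K ⊗ ℝ)` (it is homeomorphic to the convex ball). [folklore] -/
theorem val_preimage_closedBall_subset_connectedComponent {ε : ℝ} (hε0 : 0 ≤ ε)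
    (hε : Metric.closedBall (1 : Matrix (Fin n) (Fin n) (mixedSpace K)) ε ⊆
      range (Units.val : GL (Fin n) (mixedSpace K) → Matrix (Fin n) (Fin n) (mixedSpace K))) :
    (Units.val : GL (Fin n) (mixedSpace K) → Matrix (Fin n) (Fin n) (mixedSpace K)) ⁻¹'
      Metric.closedBall 1 ε ⊆ connectedComponent (1 : GL (Fin n) (mixedSpace K)) := by
  set C := (Units.val : GL (Fin n) (mixedSpace K) → Matrix (Fin n) (Fin n) (mixedSpace K)) ⁻¹'
    Metric.closedBall 1 ε with hC
  have himage : (Units.val : GL (Fin n) (mixedSpace K) → Matrix (Fin n) (Fin n) (mixedSpace K)) ''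
      C = Metric.closedBall 1 ε := image_preimage_eq_of_subset hε
  have hpre : IsPreconnected C := by
    rw [← (Units.isOpenEmbedding_val
      (R := Matrix (Fin n) (Fin n) (mixedSpace K))).isInducing.isPreconnected_image, himage]
    exact (convex_closedBall (1 : Matrix (Fin n) (Fin n) (mixedSpace K)) ε).isPreconnected
  have h1 : (1 : GL (Fin n) (mixedSpace K)) ∈ C := by
    rw [hC, mem_preimage, Units.val_one]
    exact Metric.mem_closedBall_self hε0
  exact hpre.subset_connectedComponent h1

set_option backward.isDefEq.respectTransparency false in
/-- **Small balls form a neighbourhood basis of `1` in `GL_n(K ⊗ ℝ)`**: every neighbourhood of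
`1` contains `{x | ‖x - 1‖ < ε}` for some `ε > 0` (the units topology is induced by `Units.val`).
[folklore] -/
theorem exists_norm_lt_imp_mem_of_mem_nhds {U : Set (GL (Fin n) (mixedSpace K))}
    (hU : U ∈ 𝓝 (1 : GL (Fin n) (mixedSpace K))) :
    ∃ ε > (0 : ℝ), ∀ x : GL (Fin n) (mixedSpace K),
      ‖(x : Matrix (Fin n) (Fin n) (mixedSpace K)) - 1‖ < ε → x ∈ U := by
  rw [(Units.isOpenEmbedding_val (R := Matrix (Fin n) (Fin n) (mixedSpace K))).nhds_eq_comap,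
    Units.val_one, Filter.mem_comap] at hU
  obtain ⟨W, hW, hWU⟩ := hU
  obtain ⟨ε, hε, hball⟩ := Metric.mem_nhds_iff.1 hW
  refine ⟨ε, hε, fun x hx ↦ hWU (hball ?_)⟩
  rwa [Metric.mem_ball, dist_eq_norm]

end Balls

/-! ### 3. Admissible weights (the space `J` of Borel's proof) and the invariant bumps -/

section Weights

variable (n : ℕ) (K : Type) [Field K] [NumberField K]

/-- **The admissible weights** (the space `J` of the proof of Borel 1972, Thm. 3.18, for the
group `G = GL_n(K ⊗ ℝ)°`): complex functions on `GL_n(K ⊗ ℝ)` that are continuous, compactly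
supported, smooth (`IsArchSmooth` for the full linear group), supported in the identity component,
and invariant under conjugation by `K_∞ = U(n, K ⊗ ℝ)` (hence by Borel's `K ≤ K_∞`). They form a
complex subspace. Borel 1972, 3.4 and proof of 3.18 (`J`). [cite: Borel1972, Thm. 3.18 (proof)] -/
def admissibleWeightsGL : Submodule ℂ (GL (Fin n) (mixedSpace K) → ℂ) where
  carrier := {α | Continuous α ∧ HasCompactSupport α ∧
    IsArchSmooth (archGroupGL n K).carrier.subtype α ∧
    tsupport α ⊆ connectedComponent (1 : GL (Fin n) (mixedSpace K)) ∧
    ∀ k ∈ Kinf n K, ∀ x, α (k * x * k⁻¹) = α x}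
  zero_mem' := by
    refine ⟨continuous_const, HasCompactSupport.zero, (archSmooth _).zero_mem, ?_, fun _ _ _ ↦ rfl⟩
    have : tsupport (0 : GL (Fin n) (mixedSpace K) → ℂ) = ∅ := tsupport_eq_empty_iff.2 rfl
    rw [this]
    exact empty_subset _
  add_mem' := by
    rintro α β ⟨hαc, hαs, hαsm, hαt, hαk⟩ ⟨hβc, hβs, hβsm, hβt, hβk⟩
    refine ⟨hαc.add hβc, hαs.add hβs, (archSmooth _).add_mem hαsm hβsm, ?_, fun k hk x ↦ ?_⟩
    · refine (closure_mono (Function.support_add α β)).trans ?_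
      rw [closure_union]
      exact union_subset hαt hβt
    · simp only [Pi.add_apply, hαk k hk x, hβk k hk x]
  smul_mem' := by
    rintro c α ⟨hαc, hαs, hαsm, hαt, hαk⟩
    refine ⟨hαc.const_smul c, hαs.smul_left, (archSmooth _).smul_mem c hαsm,
      (tsupport_smul_subset_right (fun _ ↦ c) α).trans hαt, fun k hk x ↦ ?_⟩
    simp only [Pi.smul_apply, hαk k hk x]

variable {n K}

/-- Membership in `admissibleWeightsGL`. [cite: Borel1972, Thm. 3.18 (proof)] -/
theorem mem_admissibleWeightsGL_iff (α : GL (Fin n) (mixedSpace K) → ℂ) :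
    α ∈ admissibleWeightsGL n K ↔ Continuous α ∧ HasCompactSupport α ∧
      IsArchSmooth (archGroupGL n K).carrier.subtype α ∧
      tsupport α ⊆ connectedComponent (1 : GL (Fin n) (mixedSpace K)) ∧
      ∀ k ∈ Kinf n K, ∀ x, α (k * x * k⁻¹) = α x :=
  Iff.rfl

-- the scoped operator norm on `𝔤𝔩_n(K_∞)`, as in `Balls`
open scoped Matrix.Norms.Operator

set_option backward.isDefEq.respectTransparency false in
/-- **The invariant bumps are admissible weights** (the Dirac sequence of Borel 1972, 3.4, made of
`Int K`-invariant elements): if the closed ball of radius `ε` around `1` in `M_n(K ⊗ ℝ)` consists of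
invertible matrices and `Q(z) < φ.r_out → ‖z‖ < ε` (`Q` the Hilbert–Schmidt form), then the
rescaled bump `x ↦ c · φ(Q(x - 1)) φ(Q(x⁻¹ - 1))` (`archBump` of `AutomorphicRepsGLCuspidalL2Step1Bump`)
is continuous, supported in the compact connected set `{x | ‖x - 1‖ ≤ ε}`, smooth along
`X ↦ x₀ exp X`, and `Ad K_∞`-invariant. [cite: Borel1972, 3.4] -/
theorem archBump_mem_admissibleWeightsGL (φ : ContDiffBump (0 : ℝ)) (c : ℝ) {ε : ℝ} (hε0 : 0 ≤ ε)
    (hε : Metric.closedBall (1 : Matrix (Fin n) (Fin n) (mixedSpace K)) ε ⊆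
      range (Units.val : GL (Fin n) (mixedSpace K) → Matrix (Fin n) (Fin n) (mixedSpace K)))
    (hφε : ∀ z : Matrix (Fin n) (Fin n) (mixedSpace K), hsQ z < φ.rOut → ‖z‖ < ε) :
    (fun x : GL (Fin n) (mixedSpace K) ↦ ((c * archBump φ x : ℝ) : ℂ)) ∈
      admissibleWeightsGL n K := by
  set C := (Units.val : GL (Fin n) (mixedSpace K) → Matrix (Fin n) (Fin n) (mixedSpace K)) ⁻¹'
    Metric.closedBall 1 ε with hC
  have hCc : IsCompact C := isCompact_val_preimage_closedBall hε
  have hCclosed : IsClosed C := Metric.isClosed_closedBall.preimage Units.continuous_val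
  -- support control
  have hsupp : Function.support (fun x : GL (Fin n) (mixedSpace K) ↦ ((c * archBump φ x : ℝ) : ℂ)) ⊆
      C := by
    intro x hx
    rw [Function.mem_support, Complex.ofReal_ne_zero] at hx
    have hx' : archBump φ x ≠ 0 := right_ne_zero_of_mul hx
    have hlt := hφε _ (hsQ_lt_of_archBump_ne_zero φ hx')
    rw [hC, mem_preimage, Metric.mem_closedBall, dist_eq_norm]
    exact hlt.le
  have htsupp : tsupport (fun x : GL (Fin n) (mixedSpace K) ↦ ((c * archBump φ x : ℝ) : ℂ)) ⊆ C :=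
    closure_minimal hsupp hCclosed
  refine ⟨Complex.continuous_ofReal.comp (continuous_const.mul (continuous_archBump φ)),
    HasCompactSupport.of_support_subset_isCompact hCc hsupp, fun g ↦ ?_,
    htsupp.trans (val_preimage_closedBall_subset_connectedComponent hε0 hε), fun k hk x ↦ ?_⟩
  · -- smoothness along `X ↦ g exp X`
    show ContDiff ℝ ∞ fun X : (archGroupGL n K).lie.toSubmodule ↦
      ((c * archBump φ (g * expGL (X : Matrix (Fin n) (Fin n) (mixedSpace K))) : ℝ) : ℂ)
    have hval : ContDiff ℝ ∞ fun X : (archGroupGL n K).lie.toSubmodule ↦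
        (X : Matrix (Fin n) (Fin n) (mixedSpace K)) :=
      (archGroupGL n K).lie.toSubmodule.subtypeL.contDiff
    exact Complex.ofRealCLM.contDiff.comp
      (contDiff_const.mul ((contDiff_archBump_mul_expGL φ g).comp hval))
  · -- `Ad K_∞`-invariance
    have hk' : star ((k : GL (Fin n) (mixedSpace K)) : Matrix (Fin n) (Fin n) (mixedSpace K)) *
        (k : Matrix (Fin n) (Fin n) (mixedSpace K)) = 1 :=
      (mem_unitarySubgroupGL_iff _).1 (Subgroup.mem_inf.1 hk).2
    simp only [archBump_conj φ hk']

set_option backward.isDefEq.respectTransparency false in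
/-- **`Ad K_∞`-invariant Dirac sequences on `GL_n(K ⊗ ℝ)`** (Borel 1972, 3.4: "on peut toujours
trouver une suite de Dirac formée d'éléments invariants par `Int_G K`"; here without averaging over
`K`, the invariance being built into the Hilbert–Schmidt form). For every Haar measure `ν` there
are real weights `β_m ≥ 0` on `GL_n(K ⊗ ℝ)`, continuous, compactly supported, of integral `1`,
whose complexifications are admissible weights (`admissibleWeightsGL`), and whose supports shrink
into every neighbourhood of `1`: `β_m = α_m / ∫ α_m` with `α_m(x) = φ_m(Q(x - 1)) φ_m(Q(x⁻¹ - 1))`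
the invariant bumps of radii `r₀ / (m + 1)` (`archBump`), by the coercivity of `Q`
(`exists_hsQ_lt_imp_norm_lt`) and `exists_norm_lt_imp_mem_of_mem_nhds`. [cite: Borel1972, 3.4] -/
theorem exists_dirac_admissibleWeightsGL [MeasurableSpace (GL (Fin n) (mixedSpace K))]
    [BorelSpace (GL (Fin n) (mixedSpace K))] (ν : Measure (GL (Fin n) (mixedSpace K)))
    [ν.IsHaarMeasure] :
    ∃ β : ℕ → GL (Fin n) (mixedSpace K) → ℝ,
      (∀ m, (fun x ↦ ((β m x : ℝ) : ℂ)) ∈ admissibleWeightsGL n K) ∧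
      (∀ m, Continuous (β m)) ∧ (∀ m, HasCompactSupport (β m)) ∧ (∀ m x, 0 ≤ β m x) ∧
      (∀ m, ∫ x, β m x ∂ν = 1) ∧
      ∀ U ∈ 𝓝 (1 : GL (Fin n) (mixedSpace K)), ∀ᶠ m in atTop, Function.support (β m) ⊆ U := by
  -- the radius `ε₀` of a compact ball of units and the matching radius `r₀` of the form `Q`
  obtain ⟨ε₀, hε₀, hball⟩ := exists_closedBall_subset_range_val (n := n) (K := K)
  obtain ⟨r₀, hr₀, hr₀ε⟩ := exists_hsQ_lt_imp_norm_lt (n := n) (K := K) hε₀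
  -- the invariant bumps of radii `r₀ / (m + 1)`
  have hrad : ∀ m : ℕ, 0 < r₀ / (m + 1) := fun m ↦ div_pos hr₀ (Nat.cast_add_one_pos m)
  let φb : ℕ → ContDiffBump (0 : ℝ) := fun m ↦
    ⟨r₀ / (m + 1) / 2, r₀ / (m + 1), half_pos (hrad m), half_lt_self (hrad m)⟩
  have hφb_rOut : ∀ m, (φb m).rOut = r₀ / (m + 1) := fun m ↦ rfl
  have hrOut_le : ∀ m, (φb m).rOut ≤ r₀ := fun m ↦ by
    rw [hφb_rOut]
    exact div_le_self hr₀.le (by exact_mod_cast Nat.le_add_left 1 m)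
  let a : ℕ → GL (Fin n) (mixedSpace K) → ℝ := fun m ↦ archBump (φb m)
  have ha_def : ∀ m x, a m x = archBump (φb m) x := fun _ _ ↦ rfl
  have ha_cont : ∀ m, Continuous (a m) := fun m ↦ continuous_archBump (φb m)
  have ha_nonneg : ∀ m x, 0 ≤ a m x := fun m x ↦ archBump_nonneg (φb m) x
  have ha_supp : ∀ m x, a m x ≠ 0 →
      ‖(x : Matrix (Fin n) (Fin n) (mixedSpace K)) - 1‖ < ε₀ := fun m x hx ↦
    hr₀ε _ ((hsQ_lt_of_archBump_ne_zero (φb m) hx).trans_le (hrOut_le m))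
  have ha_cs : ∀ m, HasCompactSupport (a m) := fun m ↦
    HasCompactSupport.of_support_subset_isCompact (isCompact_val_preimage_closedBall hball)
      fun x hx ↦ by
        rw [mem_preimage, Metric.mem_closedBall, dist_eq_norm]
        exact (ha_supp m x hx).le
  -- the masses `c_m = ∫ α_m > 0`
  let c : ℕ → ℝ := fun m ↦ ∫ x, a m x ∂ν
  have hc_def : ∀ m, c m = ∫ x, a m x ∂ν := fun _ ↦ rfl
  have ha_one : ∀ m, a m 1 ≠ 0 := fun m ↦ by
    rw [ha_def, archBump_one]
    exact one_ne_zero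
  have hc : ∀ m, 0 < c m := fun m ↦
    (ha_cont m).integral_pos_of_hasCompactSupport_nonneg_nonzero (ha_cs m) (ha_nonneg m) (ha_one m)
  -- the normalised bumps `β_m = α_m / c_m`
  refine ⟨fun m x ↦ (c m)⁻¹ * a m x, fun m ↦ ?_, fun m ↦ continuous_const.mul (ha_cont m),
    fun m ↦ (ha_cs m).mul_left, fun m x ↦ mul_nonneg (inv_nonneg.2 (hc m).le) (ha_nonneg m x),
    fun m ↦ ?_, fun U hU ↦ ?_⟩
  · -- admissibility
    exact archBump_mem_admissibleWeightsGL (φb m) (c m)⁻¹ hε₀.le hball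
      (fun z hz ↦ hr₀ε z (hz.trans_le (hrOut_le m)))
  · -- mass one
    change ∫ x, (c m)⁻¹ * a m x ∂ν = 1
    rw [integral_const_mul, ← hc_def]
    exact inv_mul_cancel₀ (hc m).ne'
  · -- the supports shrink into `U`
    obtain ⟨ε₁, hε₁, hε₁U⟩ := exists_norm_lt_imp_mem_of_mem_nhds hU
    obtain ⟨r₁, hr₁, hr₁ε⟩ := exists_hsQ_lt_imp_norm_lt (n := n) (K := K) hε₁
    obtain ⟨N, hN⟩ := exists_nat_gt (r₀ / r₁)
    refine eventually_atTop.2 ⟨N, fun m hm x hx ↦ ?_⟩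
    have hrm : (φb m).rOut < r₁ := by
      rw [hφb_rOut, div_lt_iff₀ (Nat.cast_add_one_pos m)]
      have hN' : (N : ℝ) ≤ m := by exact_mod_cast hm
      calc r₀ = r₀ / r₁ * r₁ := by field_simp
        _ < N * r₁ := by gcongr
        _ ≤ r₁ * (m + 1) := by nlinarith
    have hx' : a m x ≠ 0 := right_ne_zero_of_mul (Function.mem_support.1 hx)
    exact hε₁U x (hr₁ε _ ((hsQ_lt_of_archBump_ne_zero (φb m) hx').trans hrm))

end Weights

/-! ### 4. Harish-Chandra's admissibility theorem (named fact) -/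

section Fact

variable {n : ℕ} {K : Type} [Field K] [NumberField K]

variable (hcpt : isCompact_glFiniteIntegralLevel n K) in
/-- **Harish-Chandra's admissibility theorem (Borel 1972, Thm. 3.17) for automorphic forms on
`GL_n(𝔸_K)`**, in the form extracted by the first half of the proof of Thm. 3.18 (p. 26: "`P` … est
un sous-espace vectoriel de `W_F`", "ce dernier est de dimension finie"). For every automorphic
form `φ` on `GL_n(𝔸_K)` and every Haar measure `ν` on `GL_n(K ⊗ ℝ)` there is a finite-dimensional
complex space `V` of functions on `GL_n(𝔸_K)` containing `π(α) φ = (g ↦ ∫ φ(g x) α(x) dν(x))` for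
every admissible weight `α` (`admissibleWeightsGL`: continuous, compactly supported, smooth,
supported in the identity component `GL_n(K ⊗ ℝ)°`, `Ad K_∞`-invariant).

Not to be confused with the tree's `harishChandra_finiteness_gl` (`AutomorphicRepsGL`;
Borel–Jacquet 1979, 4.3 (i): the automorphic forms of fixed level, `Z(𝔤)`-character and
`K_∞`-types span a finite-dimensional space — a global statement resting on reduction theory):
the present fact is the admissibility of the closed module generated by ONE form under the
(semisimple part of the) archimedean group, a statement about `G_∞` alone.

In print (see the module docstring for details): Thm. 3.17 concerns a permissible continuous
representation of a connected reductive Lie group, so — as in the docstring of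
`AutomorphicRepsGL.exists_convolution_eq_self` — one reduces to the semisimple part:
`GL_n(K ⊗ ℝ)° = C · G₁`, `C` the connected centre, `G₁ = ∏_w SL_n(K_w)` connected semisimple with
finite centre (`K₁ = ∏ SO(n) × ∏ SU(n)` compact, every continuous representation of `G₁`
permissible, 3.16), acting by right translations `π₁` on `C(GL_n(𝔸_K))` (compact-open topology;
3.2, Remarks (3)–(4)). The form `φ` is a differentiable, `K₁`-finite, `Z(𝔤₁)`-finite vector
(Borel–Jacquet 1979, 4.2; `Z(𝔤) = Z(𝔤₁) ⊗ U(𝔷)`), and by `𝔷`-finiteness its central translates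
`r(c) φ`, `c ∈ C`, stay in the finite-dimensional space `E = U(𝔷) φ = ⟨φ_1, …, φ_r⟩` of such
vectors, `r(c) φ = Σ_i c_i(c) φ_i`; for an admissible `α`, `π(α) φ = Σ_i π₁(α_i) φ_i` with
`α_i = κ ∫_C α(c ·) c_i(c) dc ∈ D(G₁)` `Int K₁`-invariant (`C` central, `K₁ ≤ K_∞`). By Thm. 3.17
the closure `W(φ_i)` of `π₁(U(𝔤₁)) φ_i` is `G₁`-stable with finite-dimensional `K₁`-isotypic
components `W(φ_i)_λ`, and `π₁(α_i) φ_i ∈ W(φ_i)_{F_i}` (`F_i` the `K₁`-types of `φ_i`;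
`π₁(f) W_λ ⊆ W_λ` for `Int K₁`-invariant `f`, 3.5); take `V = Σ_i W(φ_i)_{F_i}`, which depends
neither on `α` nor on the normalisation of `ν`. This is the deep input of Harish-Chandra's
convolution identity (`AutomorphicRepsGL.exists_convolution_eq_self_of_finiteDimensional`); its
own proof rests on the analyticity of `K`-finite `Z(𝔤)`-finite vectors (3.14–3.15, elliptic
regularity) and on Harish-Chandra's algebraic finiteness theorem for `U(𝔤)`-modules (1.4–1.5).
[cite: Borel1972, Thm. 3.17 and proof of Thm. 3.18 (p. 26)] -/
def AutomorphicRepsGL.exists_finiteDimensional_convolution_mem : Prop :=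
  ∀ [MeasurableSpace (GL (Fin n) (mixedSpace K))] [BorelSpace (GL (Fin n) (mixedSpace K))]
    (ν : Measure (GL (Fin n) (mixedSpace K))) [ν.IsHaarMeasure]
    (φ : (AdelicGroupData.gl n K).Adelic → ℂ), IsAutomorphicForm (AutomorphyDatum.gl n K hcpt) φ →
      ∃ V : Submodule ℂ ((AdelicGroupData.gl n K).Adelic → ℂ), FiniteDimensional ℂ V ∧
        ∀ α ∈ admissibleWeightsGL n K,
          (fun g : GL (Fin n) (AdeleRing (𝓞 K) K) ↦ ∫ x, φ (g * GLn.ofInfinite n K x) * α x ∂ν) ∈ V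

end Fact

/-! ### 5. The convolution identity from the admissibility theorem (proof of Borel's Thm. 3.18) -/

section Soft

variable {n : ℕ} {K : Type} [Field K] [NumberField K]
  {hcpt : isCompact_glFiniteIntegralLevel n K}

-- the scoped operator norm on `𝔤𝔩_n(K_∞)`, as in `Balls`
open scoped Matrix.Norms.Operator

set_option backward.isDefEq.respectTransparency false in
/-- **Harish-Chandra's convolution identity from the admissibility theorem** (the second half of
the proof of Borel 1972, Thm. 3.18, p. 26; the identity itself is Harish-Chandra 1966, Thm. 1 =
Borel's Cor. 3.19 when `K` is compact, and Borel–Jacquet 1979, 4.3 for reductive `G`): the named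
fact
`exists_finiteDimensional_convolution_mem hcpt` implies `exists_convolution_eq_self hcpt`. Given an
automorphic form `φ` and a Haar measure `ν` on `GL_n(K ⊗ ℝ)`: the map `T : α ↦ (g ↦ ∫ φ(g x) α(x) dν)`
is linear on the admissible weights `J`, and its range `P` lies in the finite-dimensional space
`V` of the fact, hence is finite-dimensional and therefore closed in the space of all functions on
`GL_n(𝔸_K)` (topology of pointwise convergence). The normalised invariant bumps
`β_m = α_m / ∫ α_m`, `α_m(x) = φ_m(Q(x - 1)) φ_m(Q(x⁻¹ - 1))` with radii `r₀ / (m + 1)`, are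
admissible (`archBump_mem_admissibleWeightsGL`) and form a Dirac sequence: by coercivity of `Q`
their supports shrink into every neighbourhood of `1`, so `T β_m (g) → φ(g)` for every `g`
(`norm_integral_mul_sub_le` and the continuity of `φ`, `IsAutomorphicForm.continuous_gl`). Hence
`φ ∈ P̄ = P`, i.e. `φ = T α` for an admissible, in particular smooth compactly supported, `α`.
[cite: Borel1972, proof of Thm. 3.18 (p. 26)] -/
theorem AutomorphicRepsGL.exists_convolution_eq_self_of_finiteDimensional
    (h : AutomorphicRepsGL.exists_finiteDimensional_convolution_mem hcpt) :
    AutomorphicRepsGL.exists_convolution_eq_self hcpt := by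
  intro _ _ ν _ φ hφ
  obtain ⟨V, hV, hmem⟩ := h ν φ hφ
  haveI : FiniteDimensional ℂ V := hV
  have hφc : Continuous φ := hφ.continuous_gl
  -- the slices `x ↦ φ (g (x, 1))` are continuous (typed through the adelic group datum)
  have hslice : ∀ g : (AdelicGroupData.gl n K).Adelic,
      Continuous fun x : GL (Fin n) (mixedSpace K) ↦ φ (g * GLn.ofInfiniteAdelic n K x) := fun g ↦
    hφc.comp (continuous_const.mul (GLn.continuous_ofInfiniteAdelic n K))
  -- the linear map `T` on the admissible weights
  have hint : ∀ α ∈ admissibleWeightsGL n K, ∀ g : (AdelicGroupData.gl n K).Adelic,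
      Integrable (fun x ↦ φ (g * GLn.ofInfiniteAdelic n K x) * α x) ν := fun α hα g ↦
    ((hslice g).mul hα.1).integrable_of_hasCompactSupport hα.2.1.mul_left
  let T : admissibleWeightsGL n K →ₗ[ℂ] ((AdelicGroupData.gl n K).Adelic → ℂ) :=
    { toFun := fun α g ↦
        ∫ x, φ (g * GLn.ofInfiniteAdelic n K x) * (α : GL (Fin n) (mixedSpace K) → ℂ) x ∂ν
      map_add' := fun α β ↦ by
        funext g
        simp only [Submodule.coe_add, Pi.add_apply, mul_add]
        exact integral_add (hint _ α.2 g) (hint _ β.2 g)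
      map_smul' := fun c α ↦ by
        funext g
        simp only [Submodule.coe_smul, Pi.smul_apply, smul_eq_mul, RingHom.id_apply]
        rw [← integral_const_mul]
        congr 1 with x
        ring }
  -- its range is finite-dimensional, hence closed for pointwise convergence
  have hle : LinearMap.range T ≤ V := by
    intro ψ hψ
    obtain ⟨α, rfl⟩ := LinearMap.mem_range.1 hψ
    exact hmem α α.2
  haveI : FiniteDimensional ℂ (LinearMap.range T) := Submodule.finiteDimensional_of_le hle
  have hclosed : IsClosed ((LinearMap.range T :
      Submodule ℂ ((AdelicGroupData.gl n K).Adelic → ℂ)) :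
        Set ((AdelicGroupData.gl n K).Adelic → ℂ)) :=
    Submodule.closed_of_finiteDimensional _
  -- an invariant Dirac sequence of admissible weights
  obtain ⟨β, hβ_mem, hβ_cont, hβ_cs, hβ_nonneg, hβ_one, hβ_supp⟩ :=
    exists_dirac_admissibleWeightsGL (n := n) (K := K) ν
  have hβ_int : ∀ m, Integrable (β m) ν := fun m ↦
    (hβ_cont m).integrable_of_hasCompactSupport (hβ_cs m)
  let B : ℕ → admissibleWeightsGL n K := fun m ↦ ⟨fun x ↦ ((β m x : ℝ) : ℂ), hβ_mem m⟩
  have hTB : ∀ (m : ℕ) (g : (AdelicGroupData.gl n K).Adelic),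
      T (B m) g = ∫ x, φ (g * GLn.ofInfiniteAdelic n K x) * ((β m x : ℝ) : ℂ) ∂ν := fun _ _ ↦ rfl
  -- the Dirac property: `T β_m → φ` pointwise
  have htend : Tendsto (fun m ↦ T (B m)) atTop (𝓝 φ) := by
    rw [tendsto_pi_nhds]
    intro g
    have hcont := (hslice g).continuousAt (x := 1)
    have hlim := tendsto_integral_mul_of_support_subset (ν := ν) hcont hβ_nonneg hβ_one hβ_int
      (fun m ↦ hint _ (hβ_mem m) g) hβ_supp
    rw [map_one, mul_one] at hlim
    simp only [hTB]
    exact hlim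
  -- `φ` lies in the closed range
  have hφmem : φ ∈ (LinearMap.range T : Set ((AdelicGroupData.gl n K).Adelic → ℂ)) := by
    rw [← hclosed.closure_eq]
    exact mem_closure_of_tendsto htend
      (Eventually.of_forall fun m ↦ LinearMap.mem_range_self T (B m))
  have hφmem' : φ ∈ LinearMap.range T := hφmem
  obtain ⟨α, hα⟩ := LinearMap.mem_range.1 hφmem'
  refine ⟨α, α.2.1, α.2.2.1, α.2.2.2.1, fun g ↦ ?_⟩
  exact (congrFun hα g).symm

/-- **Fact 1 of Step 2 on the trust base `{exists_finiteDimensional_convolution_mem}`**: Lie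
derivatives of automorphic forms on `GL_n(𝔸_K)` have moderate growth
(`hasModerateGrowth_lieDeriv_of_HC` after `exists_convolution_eq_self_of_finiteDimensional`).
Borel–Jacquet 1979, 4.3 (ii); Borel 1972, Thm. 3.17–3.18. [cite: BorelJacquet1979, 4.3 (ii)] -/
theorem AutomorphicRepsGL.hasModerateGrowth_lieDeriv_of_finiteDimensional
    (h : AutomorphicRepsGL.exists_finiteDimensional_convolution_mem hcpt) :
    AutomorphicRepsGL.hasModerateGrowth_lieDeriv hcpt :=
  AutomorphicRepsGL.hasModerateGrowth_lieDeriv_of_HC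
    (AutomorphicRepsGL.exists_convolution_eq_self_of_finiteDimensional h)

variable {μ : Measure (AdelicGroupData.gl n K).automorphicQuotient}
  [(AdelicGroupData.gl n K).IsAutomorphicMeasure μ]

/-- **Fact 2 of Step 2 (the `L²` side of Borel–Jacquet 4.6 for `GL_n`) on the trust base
`{exists_finiteDimensional_convolution_mem}`**: Lie derivatives of the automorphic forms of a closed
invariant `Π ≤ L²(μ)` represent vectors of `Π` (`exists_toLp_mem_invQuot_eq_lieDeriv_of_HC` after
`exists_convolution_eq_self_of_finiteDimensional`). Borel 1972, Thm. 3.17 and proof of Thm. 3.18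
(in print the `L²`-differentiability is Cor. 3.20–3.21, stated there for compact `K`);
Borel–Jacquet 1979, 4.6. [cite: BorelJacquet1979, 4.6] -/
theorem AutomorphicRepsGL.exists_toLp_mem_invQuot_eq_lieDeriv_of_finiteDimensional
    (h : AutomorphicRepsGL.exists_finiteDimensional_convolution_mem hcpt) :
    AutomorphicRepsGL.exists_toLp_mem_invQuot_eq_lieDeriv hcpt μ :=
  AutomorphicRepsGL.exists_toLp_mem_invQuot_eq_lieDeriv_of_HC
    (AutomorphicRepsGL.exists_convolution_eq_self_of_finiteDimensional h)

/-- **Step 2 of Borel–Jacquet 4.6 for `GL_n` rests on Harish-Chandra's admissibility theorem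
alone**:
`exists_finiteDimensional_convolution_mem hcpt → formsOfL2_isStableSubmodule hcpt μ`.
Borel–Jacquet 1979, 4.3 (ii) and 4.6; Borel 1972, Thm. 3.17–3.18. [cite: BorelJacquet1979, 4.6] -/
theorem AutomorphicRepsGL.formsOfL2_isStableSubmodule_of_finiteDimensional
    (h : AutomorphicRepsGL.exists_finiteDimensional_convolution_mem hcpt) :
    AutomorphicRepsGL.formsOfL2_isStableSubmodule hcpt μ :=
  AutomorphicRepsGL.formsOfL2_isStableSubmodule_of_harishChandra
    (AutomorphicRepsGL.exists_convolution_eq_self_of_finiteDimensional h)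

end Soft

end Literature.NumberTheory.Automorphic
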